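import Summits.CriticalPhenomena.Ising3DConformalLimit.Theorems.EnergyNotSigmaSquaredGapForcesFarMergingSandwichNearPinchFloor
import Summits.CriticalPhenomena.Ising3DConformalLimit.Theorems.EnergyNotSigmaSquaredGapForcesFarMergingSandwichOctaveCountingAux
import HarnessLib

/-! # Octave counting: decay + hazard domination + tail tightness force far duplicated hitting
(line `one-cluster-depletion-sandwich` of crux `GapForcesFarMerging`, item stmt-CriticalPhenomena-4468;
stub `stub_octaveCounting`)

`OnePinchDecay → HazardDomination → TailTightness → FarHitIO`: the bookkeeping `octaveCounting_of_floor`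
(sibling file `…SandwichOctaveCountingAux`: contrapositive octave counting — under `¬FarHitIO` every fresh
dilated shape has small duplicated hitting beyond a dilation `2^{J₀}`, so by hazard domination the conditional
hazards of the one-pinch system are `≤ Cc + ε_k ≤ 1-λ` on the octaves `k₀ < k ≤ K+3`, and with the tail floor
`δ` and the near-pinch floor `δ₀` one gets `avoid n (pinch K) ≥ δδ₀λ^{K+3}`, beating the decay `C_d 2^{-κK}` once
`λ > 2^{-κ}` and `K` is large; the gen-1 Disproof §7 STEP 1 run backwards) fed with the NEAR-PINCH FLOOR
`nearPinchFloor` (sibling file `…SandwichNearPinchFloor`: finite-energy surgery with two disjoint escape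
corridors, one per independent duplicated cluster, uniform in the far ends).
References: Aizenman–Duminil-Copin 2021, §3.1 and §6.2 (6.11)–(6.13); Lawler 1991, ch. 3–5. -/

noncomputable section

namespace Summit.CriticalPhenomena.Ising3DConformalLimit.EnergyNotSigmaSquaredGapForcesFarMergingSandwich

open Summit.CriticalPhenomena.Ising3DConformalLimit.GapForcesFarMergingSandwich
open Summit.CriticalPhenomena.Ising3DConformalLimit.Theses.EnergyNotSigmaSquared

/-- **S5 — OCTAVE COUNTING**: one-pinch decay along doubling octaves, per-octave hazard domination by fresh
dilated shapes and tail tightness force far duplicated hitting of ONE dilated injective lattice shape,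
infinitely often (contrapositive bookkeeping `octaveCounting_of_floor` + the near-pinch floor `nearPinchFloor`).
[cite: AizenmanDuminilCopinAnnals2021, §6.2 (6.11)–(6.13)] -/
theorem stub_octaveCounting : OnePinchDecay → HazardDomination → TailTightness → FarHitIO :=
  octaveCounting_of_floor nearPinchFloor

end Summit.CriticalPhenomena.Ising3DConformalLimit.EnergyNotSigmaSquaredGapForcesFarMergingSandwich

end
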